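import Literature.Analysis.Distribution.Hypoelliptic
import Mathlib.Analysis.Calculus.LineDeriv.IntegrationByParts
import Mathlib.LinearAlgebra.Matrix.Trace
import HarnessLib

/-!
# Integration by parts for vector fields: `∫ (Xf) g = ∫ f (ᵗX g)`, `∫ (Pf) g = ∫ f (ᵗP g)`, and the energy identities of Hörmander 1967, (3.1)

Analysis/Distribution support file for the decomposition of the named fact
`Literature.Analysis.Distribution.Hormander1967_thm11` (`Hypoelliptic.lean`), first half of the
discharge of the elementary estimate (3.3) of Hörmander 1967 (`Hormander1967_est33` of
`HormanderEstimates.lean`). Hörmander (Acta Math. 119 (1967), p. 152): "After noting that the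
adjoint of `X_j` is `-X_j + a_j` where `a_j ∈ C^∞(Ω)`, the inequality is obtained by taking
`v ∈ C_0^∞(K)` and integrating by parts as follows:
`-Re ∫ v̄Pv = ∑‖X_jv‖² + Re ∑ ∫ (X_jv) a_j v̄ - ∫ X₀|v|²/2 - ∫ Re c |v|² = …`".

This file PROVES, for smooth real vector fields on a finite-dimensional real space `E` with an
additive Haar measure `μ` (the setting of `Hormander1967_thm11`):

* `integral_fderiv_apply_eq_zero`, `integral_fieldDiv_eq_zero` — `∫ ∂_v h dμ = 0` and
  `∫ div Y dμ = 0` for compactly supported `C¹` data (from Mathlib's integration by parts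
  for line derivatives, `integral_mul_fderiv_eq_neg_fderiv_mul_of_integrable`, and the trace
  written in a basis, `fieldDiv_eq_sum_coord`);
* `fieldDiv_smul_apply` — `div (hX) = Dh·X + h div X`;
* `integral_fieldDeriv_mul` — **`∫ (Xf) g dμ = ∫ f (ᵗXg) dμ`** with `ᵗX g = -Xg - (div X) g`
  (`fieldTranspose`), for smooth `f, g`, one of them compactly supported: the adjoint of `X`
  is `-X - div X` (Hörmander's `-X_j + a_j`, `a_j = -div X_j`);
* `integral_hormanderOp_mul` — **`∫ (Pf) g dμ = ∫ f (ᵗPg) dμ`** for `P = ∑ X_j² + X₀ + c`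
  (`hormanderOp`) and its formal transpose `ᵗP` (`hormanderTranspose`), justifying the action
  `⟨Pu, φ⟩ = ⟨u, ᵗPφ⟩` on distributions used in `Hypoelliptic.lean`;
* the two energy identities behind (3.1): `integral_fieldDeriv_fieldDeriv_mul_self`
  (`∫ v X(Xv) = -∫ (Xv)² - ∫ (div X) v (Xv)`) and `integral_fieldDeriv_mul_self`
  (`∫ v (Xv) = -½ ∫ (div X) v²`), and their sum `integral_mul_hormanderOp_self`
  (`∫ vPv = -∑_j ‖X_jv‖² - ∑_j ∫ (div X_j) v X_jv - ½∫ (div X₀) v² + ∫ c v²`).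

## References

* L. Hörmander, *Hypoelliptic second order differential equations*, Acta Math. 119 (1967)
  147–171, p. 152 (the computation preceding (3.1)).
-/

noncomputable section

open MeasureTheory TopologicalSpace Set Function Filter Module
open scoped ContDiff Topology

namespace Literature.Analysis.Distribution

variable {E : Type*} [NormedAddCommGroup E] [NormedSpace ℝ E] [FiniteDimensional ℝ E]
  [MeasurableSpace E] [BorelSpace E] {μ : Measure E} [μ.IsAddHaarMeasure]

/-! ### Derivatives and divergences of compactly supported data integrate to zero -/

/-- `∫ ∂_v h dμ = 0` for a compactly supported `C¹` function `h` and a Haar measure `μ`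
(integration by parts against the constant `1`). [folklore] -/
theorem integral_fderiv_apply_eq_zero {h : E → ℝ} (hh : ContDiff ℝ 1 h)
    (hhc : HasCompactSupport h) (v : E) : ∫ x, fderiv ℝ h x v ∂μ = 0 := by
  have hd : Continuous fun x => fderiv ℝ h x v :=
    (hh.continuous_fderiv one_ne_zero).clm_apply continuous_const
  have hdc : HasCompactSupport fun x => fderiv ℝ h x v := hhc.fderiv_apply (𝕜 := ℝ) v
  have key := integral_mul_fderiv_eq_neg_fderiv_mul_of_integrable (μ := μ) (f := h)
    (g := fun _ : E => (1 : ℝ)) (v := v)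
    (by simpa using hd.integrable_of_hasCompactSupport hdc) (by simp)
    (by simpa using hh.continuous.integrable_of_hasCompactSupport hhc)
    (fun x _ => (hh.differentiable one_ne_zero x)) (fun x _ => differentiableAt_const _)
  simpa using key

omit [FiniteDimensional ℝ E] [MeasurableSpace E] [BorelSpace E] in
/-- The divergence in a basis: `div Y (x) = ∑ᵢ bᵢ*(DY(x) bᵢ)`. [folklore] -/
theorem fieldDiv_eq_sum_coord {κ : Type*} [Fintype κ] [DecidableEq κ] (b : Basis κ ℝ E)
    (Y : E → E) (x : E) : fieldDiv Y x = ∑ i, b.coord i (fderiv ℝ Y x (b i)) := by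
  unfold fieldDiv
  rw [LinearMap.trace_eq_matrix_trace ℝ b, Matrix.trace]
  simp [Matrix.diag, LinearMap.toMatrix_apply]

/-- `∫ div Y dμ = 0` for a compactly supported `C¹` vector field `Y` and a Haar measure `μ`.
[folklore] -/
theorem integral_fieldDiv_eq_zero {Y : E → E} (hY : ContDiff ℝ 1 Y) (hYc : HasCompactSupport Y) :
    ∫ x, fieldDiv Y x ∂μ = 0 := by
  classical
  let b := Module.finBasis ℝ E
  have hL : ∀ i, ∀ x, b.coord i (fderiv ℝ Y x (b i)) =
      fderiv ℝ (fun y => b.coord i (Y y)) x (b i) := by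
    intro i x
    have hc : HasFDerivAt (fun y => b.coord i (Y y))
        ((LinearMap.toContinuousLinearMap (b.coord i)).comp (fderiv ℝ Y x)) x :=
      (LinearMap.toContinuousLinearMap (b.coord i)).hasFDerivAt.comp x
        ((hY.differentiable one_ne_zero x).hasFDerivAt)
    rw [hc.fderiv]
    rfl
  have hi : ∀ i, ContDiff ℝ 1 fun y => b.coord i (Y y) := fun i =>
    (LinearMap.toContinuousLinearMap (b.coord i)).contDiff.comp hY
  have hic : ∀ i, HasCompactSupport fun y => b.coord i (Y y) := fun i =>
    hYc.comp_left (map_zero _)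
  simp_rw [fieldDiv_eq_sum_coord b, hL]
  rw [integral_finsetSum]
  · exact Finset.sum_eq_zero fun i _ => integral_fderiv_apply_eq_zero (hi i) (hic i) (b i)
  · intro i _
    exact (((hi i).continuous_fderiv one_ne_zero).clm_apply continuous_const).integrable_of_hasCompactSupport
      ((hic i).fderiv_apply (𝕜 := ℝ) (b i))

omit [MeasurableSpace E] [BorelSpace E] in
/-- Product rule for the divergence: `div (hX)(x) = Dh(x)·X(x) + h(x) div X(x)`. [folklore] -/
theorem fieldDiv_smul_apply {h : E → ℝ} {X : E → E} {x : E} (hh : DifferentiableAt ℝ h x)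
    (hX : DifferentiableAt ℝ X x) :
    fieldDiv (fun y => h y • X y) x = fderiv ℝ h x (X x) + h x * fieldDiv X x := by
  rw [fieldDiv, fieldDiv, fderiv_fun_smul hh hX]
  have : ((h x • fderiv ℝ X x + (fderiv ℝ h x).smulRight (X x) : E →L[ℝ] E) : E →ₗ[ℝ] E) =
      h x • (fderiv ℝ X x : E →ₗ[ℝ] E) + (fderiv ℝ h x : E →ₗ[ℝ] ℝ).smulRight (X x) := rfl
  rw [this, map_add, map_smul, LinearMap.trace_smulRight, smul_eq_mul, add_comm]
  rfl

/-! ### `∫ (Xf) g = ∫ f (ᵗX g)` -/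

omit [FiniteDimensional ℝ E] [MeasurableSpace E] [BorelSpace E] in
/-- `Xf` is continuous for `C¹` data. [folklore] -/
theorem continuous_fieldDeriv {X : E → E} {f : E → ℝ} (hX : Continuous X)
    (hf : ContDiff ℝ 1 f) : Continuous (fieldDeriv X f) :=
  (hf.continuous_fderiv one_ne_zero).clm_apply hX

omit [MeasurableSpace E] [BorelSpace E] in
/-- `div X` is continuous for a `C¹` field. [folklore] -/
theorem continuous_fieldDiv {X : E → E} (hX : ContDiff ℝ 1 X) : Continuous (fieldDiv X) := by
  rw [fieldDiv_eq_traceCLM_comp]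
  exact traceCLM.continuous.comp (hX.continuous_fderiv one_ne_zero)

omit [FiniteDimensional ℝ E] [MeasurableSpace E] [BorelSpace E] in
/-- `Xf` has compact support if `f` has. [folklore] -/
theorem hasCompactSupport_fieldDeriv (X : E → E) {f : E → ℝ} (hfc : HasCompactSupport f) :
    HasCompactSupport (fieldDeriv X f) :=
  hfc.mono' ((subset_tsupport _).trans (tsupport_fieldDeriv_subset X f))

/-- **Integration by parts for a vector field** (Hörmander 1967, p. 152: "the adjoint of `X_j`
is `-X_j + a_j`"): `∫ (Xf) g dμ = ∫ f (ᵗX g) dμ` with `ᵗX g = -Xg - (div X) g`, for a `C¹`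
field `X`, `C¹` functions `f, g` with `f` compactly supported, and a Haar measure `μ`. Proof:
`0 = ∫ div(fgX) = ∫ [(Xf)g + f(Xg) + fg div X]`. [cite: Hormander1967, p. 152] -/
theorem integral_fieldDeriv_mul {X : E → E} {f g : E → ℝ} (hX : ContDiff ℝ 1 X)
    (hf : ContDiff ℝ 1 f) (hg : ContDiff ℝ 1 g) (hfc : HasCompactSupport f) :
    ∫ x, fieldDeriv X f x * g x ∂μ = ∫ x, f x * fieldTranspose X g x ∂μ := by
  -- the compactly supported field `Y = (fg) X` and its divergence
  set Y : E → E := fun y => (f y * g y) • X y with hY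
  have hfg : ContDiff ℝ 1 fun y => f y * g y := hf.mul hg
  have hYd : ContDiff ℝ 1 Y := hfg.smul hX
  have hYc : HasCompactSupport Y := (hfc.mul_right (f' := g)).smul_right (f' := X)
  have hdiv : ∀ x, fieldDiv Y x =
      (fieldDeriv X f x * g x + f x * fieldDeriv X g x) + f x * g x * fieldDiv X x := by
    intro x
    rw [hY, fieldDiv_smul_apply ((hfg.differentiable one_ne_zero) x) ((hX.differentiable one_ne_zero) x),
      fderiv_fun_mul ((hf.differentiable one_ne_zero) x) ((hg.differentiable one_ne_zero) x)]
    simp only [fieldDeriv_apply, add_apply, smul_apply, smul_eq_mul]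
    ring
  -- integrability of the three terms
  have hXc : Continuous X := hX.continuous
  have i₁ : Integrable (fun x => fieldDeriv X f x * g x) μ :=
    ((continuous_fieldDeriv hXc hf).mul hg.continuous).integrable_of_hasCompactSupport
      ((hasCompactSupport_fieldDeriv X hfc).mul_right)
  have i₂ : Integrable (fun x => f x * fieldDeriv X g x) μ :=
    (hf.continuous.mul (continuous_fieldDeriv hXc hg)).integrable_of_hasCompactSupport
      hfc.mul_right
  have i₃ : Integrable (fun x => f x * g x * fieldDiv X x) μ :=
    ((hf.continuous.mul hg.continuous).mul (continuous_fieldDiv hX)).integrable_of_hasCompactSupport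
      (hfc.mul_right.mul_right)
  have i₁₂ : Integrable (fun x => fieldDeriv X f x * g x + f x * fieldDeriv X g x) μ := i₁.add i₂
  have h0 : ∫ x, ((fieldDeriv X f x * g x + f x * fieldDeriv X g x) +
      f x * g x * fieldDiv X x) ∂μ = 0 :=
    (integral_congr_ae (Eventually.of_forall fun x => (hdiv x).symm)).trans
      (integral_fieldDiv_eq_zero (μ := μ) hYd hYc)
  rw [integral_add i₁₂ i₃, integral_add i₁ i₂] at h0
  have e : (fun x => f x * fieldTranspose X g x) =
      fun x => -(f x * fieldDeriv X g x) - f x * g x * fieldDiv X x := by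
    ext x; simp only [fieldTranspose]; ring
  have i₂n : Integrable (fun x => -(f x * fieldDeriv X g x)) μ := i₂.neg
  rw [e, integral_sub i₂n i₃, integral_neg]
  linarith

/-- The symmetric version: `∫ (Xf) g dμ = ∫ f (ᵗX g) dμ` when `g` (rather than `f`) is compactly
supported. [folklore] -/
theorem integral_fieldDeriv_mul' {X : E → E} {f g : E → ℝ} (hX : ContDiff ℝ 1 X)
    (hf : ContDiff ℝ 1 f) (hg : ContDiff ℝ 1 g) (hgc : HasCompactSupport g) :
    ∫ x, fieldDeriv X f x * g x ∂μ = ∫ x, f x * fieldTranspose X g x ∂μ := by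
  -- same proof with the compactly supported field `(fg) X`
  set Y : E → E := fun y => (f y * g y) • X y with hY
  have hfg : ContDiff ℝ 1 fun y => f y * g y := hf.mul hg
  have hYd : ContDiff ℝ 1 Y := hfg.smul hX
  have hYc : HasCompactSupport Y := (hgc.mul_left (f := f)).smul_right (f' := X)
  have hdiv : ∀ x, fieldDiv Y x =
      (fieldDeriv X f x * g x + f x * fieldDeriv X g x) + f x * g x * fieldDiv X x := by
    intro x
    rw [hY, fieldDiv_smul_apply ((hfg.differentiable one_ne_zero) x) ((hX.differentiable one_ne_zero) x),
      fderiv_fun_mul ((hf.differentiable one_ne_zero) x) ((hg.differentiable one_ne_zero) x)]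
    simp only [fieldDeriv_apply, add_apply, smul_apply, smul_eq_mul]
    ring
  have hXc : Continuous X := hX.continuous
  have i₁ : Integrable (fun x => fieldDeriv X f x * g x) μ :=
    ((continuous_fieldDeriv hXc hf).mul hg.continuous).integrable_of_hasCompactSupport
      hgc.mul_left
  have i₂ : Integrable (fun x => f x * fieldDeriv X g x) μ :=
    (hf.continuous.mul (continuous_fieldDeriv hXc hg)).integrable_of_hasCompactSupport
      ((hasCompactSupport_fieldDeriv X hgc).mul_left)
  have i₃ : Integrable (fun x => f x * g x * fieldDiv X x) μ :=
    ((hf.continuous.mul hg.continuous).mul (continuous_fieldDiv hX)).integrable_of_hasCompactSupport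
      (hgc.mul_left.mul_right)
  have i₁₂ : Integrable (fun x => fieldDeriv X f x * g x + f x * fieldDeriv X g x) μ := i₁.add i₂
  have h0 : ∫ x, ((fieldDeriv X f x * g x + f x * fieldDeriv X g x) +
      f x * g x * fieldDiv X x) ∂μ = 0 :=
    (integral_congr_ae (Eventually.of_forall fun x => (hdiv x).symm)).trans
      (integral_fieldDiv_eq_zero (μ := μ) hYd hYc)
  rw [integral_add i₁₂ i₃, integral_add i₁ i₂] at h0
  have e : (fun x => f x * fieldTranspose X g x) =
      fun x => -(f x * fieldDeriv X g x) - f x * g x * fieldDiv X x := by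
    ext x; simp only [fieldTranspose]; ring
  have i₂n : Integrable (fun x => -(f x * fieldDeriv X g x)) μ := i₂.neg
  rw [e, integral_sub i₂n i₃, integral_neg]
  linarith

/-! ### `∫ (Pf) g = ∫ f (ᵗP g)` -/

variable {ι : Type*} [Fintype ι]

/-- **The formal transpose of Hörmander's operator**: `∫ (Pf) g dμ = ∫ f (ᵗPg) dμ` for
`P = ∑_j X_j² + X₀ + c` with smooth coefficients, smooth `f, g` and `f` compactly supported
(so `⟨Pu, φ⟩ := ⟨u, ᵗPφ⟩` extends the action of `P` from functions to distributions).
[folklore] -/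
theorem integral_hormanderOp_mul {X₀ : E → E} {X : ι → E → E} {c f g : E → ℝ}
    (hX₀ : ContDiff ℝ ∞ X₀) (hX : ∀ j, ContDiff ℝ ∞ (X j)) (hc : ContDiff ℝ ∞ c)
    (hf : ContDiff ℝ ∞ f) (hg : ContDiff ℝ ∞ g) (hfc : HasCompactSupport f) :
    ∫ x, hormanderOp X₀ X c f x * g x ∂μ = ∫ x, f x * hormanderTranspose X₀ X c g x ∂μ := by
  have h1 : ∀ {Z : E → E}, ContDiff ℝ ∞ Z → ContDiff ℝ 1 Z := fun h => h.of_le (by exact_mod_cast le_top)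
  have hf1 : ContDiff ℝ 1 f := hf.of_le (by exact_mod_cast le_top)
  have hg1 : ContDiff ℝ 1 g := hg.of_le (by exact_mod_cast le_top)
  -- second-order terms
  have hsq : ∀ j, ∫ x, fieldDeriv (X j) (fieldDeriv (X j) f) x * g x ∂μ =
      ∫ x, f x * fieldTranspose (X j) (fieldTranspose (X j) g) x ∂μ := by
    intro j
    have hXf : ContDiff ℝ ∞ (fieldDeriv (X j) f) := contDiff_fieldDeriv (hX j) hf
    have hXg : ContDiff ℝ ∞ (fieldTranspose (X j) g) := contDiff_fieldTranspose (hX j) hg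
    rw [integral_fieldDeriv_mul (h1 (hX j)) (hXf.of_le (by exact_mod_cast le_top)) hg1
      (hasCompactSupport_fieldDeriv (X j) hfc),
      integral_fieldDeriv_mul (h1 (hX j)) hf1 (hXg.of_le (by exact_mod_cast le_top)) hfc]
  -- integrability
  have iP : ∀ j, Integrable (fun x => fieldDeriv (X j) (fieldDeriv (X j) f) x * g x) μ := fun j =>
    ((contDiff_fieldDeriv (hX j) (contDiff_fieldDeriv (hX j) hf)).continuous.mul
      hg.continuous).integrable_of_hasCompactSupport
      ((hasCompactSupport_fieldDeriv (X j) (hasCompactSupport_fieldDeriv (X j) hfc)).mul_right)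
  have i0 : Integrable (fun x => fieldDeriv X₀ f x * g x) μ :=
    ((contDiff_fieldDeriv hX₀ hf).continuous.mul hg.continuous).integrable_of_hasCompactSupport
      ((hasCompactSupport_fieldDeriv X₀ hfc).mul_right)
  have ic : Integrable (fun x => c x * f x * g x) μ :=
    ((hc.continuous.mul hf.continuous).mul hg.continuous).integrable_of_hasCompactSupport
      (hfc.mul_left.mul_right)
  have iP' : ∀ j, Integrable (fun x => f x * fieldTranspose (X j) (fieldTranspose (X j) g) x) μ :=
    fun j => (hf.continuous.mul (contDiff_fieldTranspose (hX j)
      (contDiff_fieldTranspose (hX j) hg)).continuous).integrable_of_hasCompactSupport hfc.mul_right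
  have i0' : Integrable (fun x => f x * fieldTranspose X₀ g x) μ :=
    (hf.continuous.mul (contDiff_fieldTranspose hX₀ hg).continuous).integrable_of_hasCompactSupport
      hfc.mul_right
  have ic' : Integrable (fun x => f x * (c x * g x)) μ :=
    (hf.continuous.mul (hc.continuous.mul hg.continuous)).integrable_of_hasCompactSupport
      hfc.mul_right
  -- expand both sides
  have eL : (fun x => hormanderOp X₀ X c f x * g x) = fun x =>
      (∑ j, fieldDeriv (X j) (fieldDeriv (X j) f) x * g x) + fieldDeriv X₀ f x * g x +
        c x * f x * g x := by
    ext x; simp only [hormanderOp, Finset.sum_mul, add_mul]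
  have eR : (fun x => f x * hormanderTranspose X₀ X c g x) = fun x =>
      (∑ j, f x * fieldTranspose (X j) (fieldTranspose (X j) g) x) +
        f x * fieldTranspose X₀ g x + f x * (c x * g x) := by
    ext x; simp only [hormanderTranspose, Finset.mul_sum, mul_add]
  have iS : Integrable (fun x => ∑ j, fieldDeriv (X j) (fieldDeriv (X j) f) x * g x) μ :=
    integrable_finsetSum _ fun j _ => iP j
  have iS0 : Integrable (fun x => (∑ j, fieldDeriv (X j) (fieldDeriv (X j) f) x * g x) +
      fieldDeriv X₀ f x * g x) μ := iS.add i0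
  have iS' : Integrable (fun x => ∑ j, f x * fieldTranspose (X j) (fieldTranspose (X j) g) x) μ :=
    integrable_finsetSum _ fun j _ => iP' j
  have iS0' : Integrable (fun x => (∑ j, f x * fieldTranspose (X j) (fieldTranspose (X j) g) x) +
      f x * fieldTranspose X₀ g x) μ := iS'.add i0'
  rw [eL, eR, integral_add iS0 ic, integral_add iS i0, integral_finsetSum _ fun j _ => iP j,
    integral_add iS0' ic', integral_add iS' i0', integral_finsetSum _ fun j _ => iP' j]
  simp only [hsq, integral_fieldDeriv_mul (h1 hX₀) hf1 hg1 hfc]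
  congr 1
  exact integral_congr_ae (Eventually.of_forall fun x => by ring)

/-! ### The energy identities behind (3.1) -/

/-- `∫ (X(Xv)) v dμ = -∫ (Xv)² dμ - ∫ (div X) v (Xv) dμ` for smooth `X` and smooth compactly
supported `v` (Hörmander 1967, p. 152: `Re ∑ ∫ (X_jv - a_jv)·X_jv̄`, i.e. the term `‖X_jv‖²`
and the lower-order term with `a_j = -div X_j`). [cite: Hormander1967, p. 152] -/
theorem integral_fieldDeriv_fieldDeriv_mul_self {X : E → E} {v : E → ℝ} (hX : ContDiff ℝ ∞ X)
    (hv : ContDiff ℝ ∞ v) (hvc : HasCompactSupport v) :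
    ∫ x, fieldDeriv X (fieldDeriv X v) x * v x ∂μ =
      -∫ x, fieldDeriv X v x ^ 2 ∂μ - ∫ x, fieldDiv X x * v x * fieldDeriv X v x ∂μ := by
  have hX1 : ContDiff ℝ 1 X := hX.of_le (by exact_mod_cast le_top)
  have hv1 : ContDiff ℝ 1 v := hv.of_le (by exact_mod_cast le_top)
  have hXv : ContDiff ℝ ∞ (fieldDeriv X v) := contDiff_fieldDeriv hX hv
  rw [integral_fieldDeriv_mul hX1 (hXv.of_le (by exact_mod_cast le_top)) hv1
    (hasCompactSupport_fieldDeriv X hvc)]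
  have hsq : HasCompactSupport fun x => fieldDeriv X v x ^ 2 := by
    have : (fun x => fieldDeriv X v x ^ 2) = fieldDeriv X v * fieldDeriv X v := by
      ext x; simp [sq]
    rw [this]
    exact (hasCompactSupport_fieldDeriv X hvc).mul_right
  have i₁ : Integrable (fun x => fieldDeriv X v x ^ 2) μ :=
    (hXv.continuous.pow 2).integrable_of_hasCompactSupport hsq
  have i₂ : Integrable (fun x => fieldDiv X x * v x * fieldDeriv X v x) μ :=
    (((continuous_fieldDiv hX1).mul hv.continuous).mul hXv.continuous).integrable_of_hasCompactSupport
      (hasCompactSupport_fieldDeriv X hvc).mul_left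
  have e : (fun x => fieldDeriv X v x * fieldTranspose X v x) =
      fun x => -(fieldDeriv X v x ^ 2) - fieldDiv X x * v x * fieldDeriv X v x := by
    ext x; simp only [fieldTranspose, fieldDeriv_apply]; ring
  have i₁n : Integrable (fun x => -(fieldDeriv X v x ^ 2)) μ := i₁.neg
  rw [e, integral_sub i₁n i₂, integral_neg]

/-- `∫ (Xv) v dμ = -½ ∫ (div X) v² dμ` for smooth `X` and smooth compactly supported `v`
(Hörmander 1967, p. 152: the term `-∫ X₀|v|²/2 = ½∫ a₀|v|²`). [cite: Hormander1967, p. 152] -/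
theorem integral_fieldDeriv_mul_self {X : E → E} {v : E → ℝ} (hX : ContDiff ℝ ∞ X)
    (hv : ContDiff ℝ ∞ v) (hvc : HasCompactSupport v) :
    ∫ x, fieldDeriv X v x * v x ∂μ = -(1 / 2) * ∫ x, fieldDiv X x * v x ^ 2 ∂μ := by
  have hX1 : ContDiff ℝ 1 X := hX.of_le (by exact_mod_cast le_top)
  have hv1 : ContDiff ℝ 1 v := hv.of_le (by exact_mod_cast le_top)
  have hXv : ContDiff ℝ ∞ (fieldDeriv X v) := contDiff_fieldDeriv hX hv
  have h := integral_fieldDeriv_mul (μ := μ) hX1 hv1 hv1 hvc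
  have hsq : HasCompactSupport fun x => fieldDiv X x * v x ^ 2 := by
    have : (fun x => fieldDiv X x * v x ^ 2) = (fieldDiv X * v) * v := by
      ext x; simp [sq, mul_assoc]
    rw [this]
    exact (hvc.mul_left (f := fieldDiv X)).mul_right
  have i₁ : Integrable (fun x => fieldDeriv X v x * v x) μ :=
    (hXv.continuous.mul hv.continuous).integrable_of_hasCompactSupport hvc.mul_left
  have i₂ : Integrable (fun x => fieldDiv X x * v x ^ 2) μ :=
    ((continuous_fieldDiv hX1).mul (hv.continuous.pow 2)).integrable_of_hasCompactSupport hsq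
  have e : (fun x => v x * fieldTranspose X v x) =
      fun x => -(fieldDeriv X v x * v x) - fieldDiv X x * v x ^ 2 := by
    ext x; simp only [fieldTranspose, fieldDeriv_apply]; ring
  have i₁n : Integrable (fun x => -(fieldDeriv X v x * v x)) μ := i₁.neg
  rw [e, integral_sub i₁n i₂, integral_neg] at h
  linarith

/-- **The energy identity behind (3.1)** (Hörmander 1967, p. 152, for real `v`):
`∫ v Pv dμ = -∑_j ‖X_jv‖² - ∑_j ∫ (div X_j) v (X_jv) - ½∫ (div X₀) v² + ∫ c v²` for
`P = ∑_j X_j² + X₀ + c` and smooth compactly supported `v`. [cite: Hormander1967, eq. (3.1)] -/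
theorem integral_mul_hormanderOp_self {X₀ : E → E} {X : ι → E → E} {c v : E → ℝ}
    (hX₀ : ContDiff ℝ ∞ X₀) (hX : ∀ j, ContDiff ℝ ∞ (X j)) (hc : ContDiff ℝ ∞ c)
    (hv : ContDiff ℝ ∞ v) (hvc : HasCompactSupport v) :
    ∫ x, v x * hormanderOp X₀ X c v x ∂μ =
      -(∑ j, ∫ x, fieldDeriv (X j) v x ^ 2 ∂μ)
        - (∑ j, ∫ x, fieldDiv (X j) x * v x * fieldDeriv (X j) v x ∂μ)
        - (1 / 2) * ∫ x, fieldDiv X₀ x * v x ^ 2 ∂μ + ∫ x, c x * v x ^ 2 ∂μ := by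
  -- integrability of the summands of `v Pv`
  have iP : ∀ j, Integrable (fun x => fieldDeriv (X j) (fieldDeriv (X j) v) x * v x) μ := fun j =>
    ((contDiff_fieldDeriv (hX j) (contDiff_fieldDeriv (hX j) hv)).continuous.mul
      hv.continuous).integrable_of_hasCompactSupport hvc.mul_left
  have i0 : Integrable (fun x => fieldDeriv X₀ v x * v x) μ :=
    ((contDiff_fieldDeriv hX₀ hv).continuous.mul hv.continuous).integrable_of_hasCompactSupport
      hvc.mul_left
  have hsq : HasCompactSupport fun x => c x * v x ^ 2 := by
    have : (fun x => c x * v x ^ 2) = (c * v) * v := by ext x; simp [sq, mul_assoc]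
    rw [this]
    exact (hvc.mul_left (f := c)).mul_right
  have ic : Integrable (fun x => c x * v x ^ 2) μ :=
    (hc.continuous.mul (hv.continuous.pow 2)).integrable_of_hasCompactSupport hsq
  have eL : (fun x => v x * hormanderOp X₀ X c v x) = fun x =>
      (∑ j, fieldDeriv (X j) (fieldDeriv (X j) v) x * v x) + fieldDeriv X₀ v x * v x +
        c x * v x ^ 2 := by
    ext x
    simp only [hormanderOp, mul_add, Finset.mul_sum]
    congr 1
    · congr 1
      · exact Finset.sum_congr rfl fun j _ => mul_comm _ _
      · ring
    · ring
  have iS : Integrable (fun x => ∑ j, fieldDeriv (X j) (fieldDeriv (X j) v) x * v x) μ :=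
    integrable_finsetSum _ fun j _ => iP j
  have iS0 : Integrable (fun x => (∑ j, fieldDeriv (X j) (fieldDeriv (X j) v) x * v x) +
      fieldDeriv X₀ v x * v x) μ := iS.add i0
  rw [eL, integral_add iS0 ic, integral_add iS i0, integral_finsetSum _ fun j _ => iP j,
    Finset.sum_congr rfl fun j _ => integral_fieldDeriv_fieldDeriv_mul_self (μ := μ) (hX j) hv hvc,
    integral_fieldDeriv_mul_self (μ := μ) hX₀ hv hvc, Finset.sum_sub_distrib,
    Finset.sum_neg_distrib]
  ring

end Literature.Analysis.Distribution
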